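import Summits.HubbardSuperconductivity.HubbardSuperconductivity.Theorems.WeakCouplingBCSKlLindhardEnclosureBdryRecords
import Mathlib.MeasureTheory.Function.JacobianOneDim
import Mathlib.Analysis.SpecialFunctions.Integrals.Basic

/-!
# KL-MARGIN-SCAN reader (22) «kernel-lindhard-enclosure» — the COSINE SUBSTITUTION on one coordinate and the `1/(S u + V)` integral

Generic analytic bricks for the three curved-cell rules (boundary floor, majorised hyperbola, tip), which pass from a coordinate `y` of the
straddling point to the cosine `b = cos y`: (§1) the one-dimensional change of variables on a closed interval where `cos` is injective
(Mathlib `MeasureTheory.integral_image_eq_integral_abs_deriv_smul`: `∫_{cos '' I} g = ∫_I |sin y| · g (cos y) dy`), turned into the two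
INEQUALITIES the kernel uses — with a CHECKED LOWER sine bound `τ ≤ |sin|` (ceiling rules: `∫_I g∘cos ≤ τ⁻¹ ∫_{cos '' I} g`) and with a
CHECKED UPPER sine bound `|sin| ≤ σ` (floor rule: `σ⁻¹ ∫_{cos '' I} g ≤ ∫_I g∘cos`), for non-negative `g`; plus the image containment in an
outer range and the passage to a larger / smaller `b`-interval; (§2) the explicit integral `∫ db/(S(b − β) + V) = S⁻¹ · log(ratio)` and its
`log(1 + S L/V)/S` majorant used by the majorised-hyperbola rule.  Honest framing: elementary analysis; nothing in this file asserts a KL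
margin at any `t′ ≠ 0`, `K₃`, `U₀`, the window or B1g dominance; a Kohn–Luttinger instability statement is not ODLRO and nothing here proves
superconductivity in the Hubbard model.  (p1 g26, 2026-08-29.)
-/

noncomputable section

set_option linter.dupNamespace false

namespace Summit.HubbardSuperconductivity.HubbardSuperconductivity.Theorems.KlLindhardEnclosure

open Real Set MeasureTheory
open Summit.HubbardSuperconductivity.HubbardSuperconductivity.Theorems

/-! ## §1 The cosine substitution on one coordinate -/

/-- The change of variables `b = cos y` on a closed interval where `cos` is injective:
`∫_{cos '' [y0, y1]} g = ∫_{[y0, y1]} |sin y| · g(cos y) dy`. -/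
theorem integral_image_cos (y0 y1 : ℝ) (hinj : InjOn Real.cos (Icc y0 y1)) (g : ℝ → ℝ) :
    ∫ b in Real.cos '' Icc y0 y1, g b = ∫ y in Icc y0 y1, |Real.sin y| * g (Real.cos y) := by
  have h := MeasureTheory.integral_image_eq_integral_abs_deriv_smul (f := Real.cos) (f' := fun y => -Real.sin y)
    (measurableSet_Icc (a := y0) (b := y1)) (fun y _ => (Real.hasDerivAt_cos y).hasDerivWithinAt) hinj g
  simpa [abs_neg, smul_eq_mul] using h

/-- Integrability of `|sin y| · g(cos y)` from that of `g(cos y)` (bounded continuous factor). -/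
theorem integrableOn_abs_sin_mul {y0 y1 : ℝ} {g : ℝ → ℝ} (hgi : IntegrableOn (fun y => g (Real.cos y)) (Icc y0 y1) volume) (c : ℝ) :
    IntegrableOn (fun y => c * |Real.sin y| * g (Real.cos y)) (Icc y0 y1) volume := by
  have hmeas : AEStronglyMeasurable (fun y => c * |Real.sin y|) (volume.restrict (Icc y0 y1)) := by
    have : Continuous fun y => c * |Real.sin y| := by fun_prop
    exact this.aestronglyMeasurable
  have hbdd : ∀ᵐ y ∂(volume.restrict (Icc y0 y1)), ‖c * |Real.sin y|‖ ≤ |c| :=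
    Filter.Eventually.of_forall fun y => by
      rw [Real.norm_eq_abs, abs_mul, abs_abs]; exact mul_le_of_le_one_right (abs_nonneg _) (Real.abs_sin_le_one y)
  have h : IntegrableOn (fun y => c * |Real.sin y| * g (Real.cos y)) (Icc y0 y1) volume := hgi.bdd_mul hmeas hbdd
  exact h

/-- **CEILING-SIDE SUBSTITUTION**: with a lower sine bound `0 < τ ≤ |sin y|` on `[y0, y1]` and `g ≥ 0`,
`∫_{[y0,y1]} g(cos y) dy ≤ τ⁻¹ · ∫_{cos '' [y0,y1]} g`. -/
theorem setIntegral_comp_cos_le {y0 y1 τ : ℝ} (hτ : 0 < τ) (hinj : InjOn Real.cos (Icc y0 y1))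
    (hsin : ∀ y ∈ Icc y0 y1, τ ≤ |Real.sin y|) {g : ℝ → ℝ} (hg0 : ∀ b, 0 ≤ g b)
    (hgi : IntegrableOn (fun y => g (Real.cos y)) (Icc y0 y1) volume) :
    ∫ y in Icc y0 y1, g (Real.cos y) ≤ τ⁻¹ * ∫ b in Real.cos '' Icc y0 y1, g b := by
  rw [integral_image_cos y0 y1 hinj g, ← integral_const_mul]
  have hI := integrableOn_abs_sin_mul hgi τ⁻¹
  refine setIntegral_mono_on hgi (hI.congr_fun (fun y _ => by ring) measurableSet_Icc) measurableSet_Icc fun y hy => ?_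
  have h1 := hsin y hy
  have h2 := hg0 (Real.cos y)
  have h3 : 1 ≤ τ⁻¹ * |Real.sin y| := by
    rw [inv_mul_eq_div, le_div_iff₀ hτ]; linarith
  nlinarith

/-- **FLOOR-SIDE SUBSTITUTION**: with an upper sine bound `|sin y| ≤ σ`, `0 < σ`, on `[y0, y1]` and `g ≥ 0`,
`σ⁻¹ · ∫_{cos '' [y0,y1]} g ≤ ∫_{[y0,y1]} g(cos y) dy`. -/
theorem le_setIntegral_comp_cos {y0 y1 σ : ℝ} (hσ : 0 < σ) (hinj : InjOn Real.cos (Icc y0 y1))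
    (hsin : ∀ y ∈ Icc y0 y1, |Real.sin y| ≤ σ) {g : ℝ → ℝ} (hg0 : ∀ b, 0 ≤ g b)
    (hgi : IntegrableOn (fun y => g (Real.cos y)) (Icc y0 y1) volume) :
    σ⁻¹ * ∫ b in Real.cos '' Icc y0 y1, g b ≤ ∫ y in Icc y0 y1, g (Real.cos y) := by
  rw [integral_image_cos y0 y1 hinj g, ← integral_const_mul]
  have hI := integrableOn_abs_sin_mul hgi σ⁻¹
  refine setIntegral_mono_on (hI.congr_fun (fun y _ => by ring) measurableSet_Icc) hgi measurableSet_Icc fun y hy => ?_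
  have h1 := hsin y hy
  have h2 := hg0 (Real.cos y)
  have h3 : σ⁻¹ * |Real.sin y| ≤ 1 := by
    rw [inv_mul_eq_div, div_le_one hσ]; exact h1
  nlinarith [abs_nonneg (Real.sin y)]

/-- The cosine image of an interval lies in any outer range valid pointwise. -/
theorem cos_image_subset_Icc {y0 y1 lo hi : ℝ} (h : ∀ y ∈ Icc y0 y1, lo ≤ Real.cos y ∧ Real.cos y ≤ hi) :
    Real.cos '' Icc y0 y1 ⊆ Icc lo hi := by
  rintro b ⟨y, hy, rfl⟩; exact h y hy

/-- Enlarging the `b`-range can only increase the integral of a non-negative `g` (integrable on the larger set). -/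
theorem setIntegral_mono_of_subset_nonneg {s t : Set ℝ} {g : ℝ → ℝ} (hst : s ⊆ t) (hg0 : ∀ b, 0 ≤ g b)
    (hgt : IntegrableOn g t volume) : ∫ b in s, g b ≤ ∫ b in t, g b :=
  setIntegral_mono_set hgt (Filter.Eventually.of_forall fun b => hg0 b) (Filter.Eventually.of_forall hst)

/-! ## §2 The `1/(S(b − β) + V)` integral -/

/-- **THE EXPLICIT INTEGRAL**: for `0 < S`, `0 < S(b0 − β) + V` and `b0 ≤ b1`,
`∫_{b0}^{b1} db/(S(b − β) + V) = S⁻¹ · log((S(b1 − β) + V)/(S(b0 − β) + V))`. -/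
theorem integral_inv_affine {S V β b0 b1 : ℝ} (hS : 0 < S) (hpos : 0 < S * (b0 - β) + V) (h01 : b0 ≤ b1) :
    ∫ b in b0..b1, 1 / (S * (b - β) + V) = S⁻¹ * Real.log ((S * (b1 - β) + V) / (S * (b0 - β) + V)) := by
  have e : (fun b => 1 / (S * (b - β) + V)) = fun b => (fun x : ℝ => 1 / x) (S * b + (V - S * β)) := by
    funext b; ring_nf
  rw [e, intervalIntegral.integral_comp_mul_add (fun x : ℝ => 1 / x) hS.ne' (V - S * β)]
  have hpos1 : 0 < S * (b1 - β) + V := by nlinarith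
  have hnot : (0 : ℝ) ∉ uIcc (S * b0 + (V - S * β)) (S * b1 + (V - S * β)) := by
    rw [uIcc_of_le (by nlinarith)]
    intro h0
    have := h0.1
    linarith
  rw [integral_one_div hnot, smul_eq_mul]
  congr 1
  congr 1
  ring

/-- **THE MAJORANT USED BY THE HYPERBOLA RULE**: for `0 < S`, `0 < V`, `m ≤ B`, `B − m ≤ L`:
`∫_m^B db/(S(b − m) + V) ≤ S⁻¹ · log(1 + S·L/V)`. -/
theorem integral_inv_affine_le {S V m B L : ℝ} (hS : 0 < S) (hV : 0 < V) (hmB : m ≤ B) (hL : B - m ≤ L) :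
    ∫ b in m..B, 1 / (S * (b - m) + V) ≤ S⁻¹ * Real.log (1 + S * L / V) := by
  rw [integral_inv_affine hS (by simpa using hV) hmB]
  refine mul_le_mul_of_nonneg_left ?_ (inv_nonneg.mpr hS.le)
  apply Real.log_le_log
  · apply div_pos (by nlinarith) (by simpa using hV)
  · rw [show S * (m - m) + V = V by ring, div_le_iff₀ hV]
    have : S * (B - m) ≤ S * L := mul_le_mul_of_nonneg_left hL hS.le
    have e : (1 + S * L / V) * V = V + S * L := by field_simp
    rw [e]; linarith

/-- Pointwise domination on the crescent (occupied side): for `Smin ≤ S`, `m ≤ b`, `b⋆ ≤ m`, `V ≤ W`: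
`1/(S(b − b⋆) + W) ≤ 1/(Smin(b − m) + V)` (all denominators positive). -/
theorem inv_crescent_le {S Smin V W b bstar m : ℝ} (hSmin : 0 < Smin) (hS : Smin ≤ S) (hV : 0 < V) (hVW : V ≤ W)
    (hbm : m ≤ b) (hstar : bstar ≤ m) : 1 / (S * (b - bstar) + W) ≤ 1 / (Smin * (b - m) + V) := by
  apply one_div_le_one_div_of_le
  · nlinarith
  · nlinarith [mul_le_mul hS (by linarith : b - m ≤ b - bstar) (by linarith) (by linarith)]

end Summit.HubbardSuperconductivity.HubbardSuperconductivity.Theorems.KlLindhardEnclosure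

end
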